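import Summits.BirchSwinnertonDyer.BirchSwinnertonDyer.Theorems.CumulativeHeegnerLeopoldtCumulativeHeegnerInclusionAtThreeUnrSeriesDomination
import HarnessLib

/-!
# Crux K1 `CumulativeHeegnerInclusionAtThree` (stmt-BirchSwinnertonDyer-24198), line `birth` — STUB A
# (`TemperedHeegnerInclusionAtThree`, crux 26896): the `T`-ADIC PIN — from a divisibility in
# `Λ^ur[1/p, 1/T]` (`p^μ T^ν · L ∈ (g)`) to the divisibility of stub A (`p^μ · L ∈ (g)`) under
# `ord_T g ≤ ord_T L`, and its values-currency form

Width seat bsd-line-chl-k1-p1-w2 (`--supports stmt-BirchSwinnertonDyer-24198`); the Λ^ur-adapter lane ceded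
by the K1 lead (bsd-line-chl-k1-p1 g3, STATUS 09:41Z): «(∃ μ ν, span{p^μ T^ν L} ≤ (g)) → order_T g ≤
order_T L → ∃ μ, span{p^μ L} ≤ (g) over R₀⟦T⟧ (T prime, cancel T one power at a time; no UFD needed) =
where a twist-rank / corank-1 hypothesis would enter A» (evidence #28 §4b on 24198: for a residually
REDUCIBLE `T = T₃E` a Kolyvagin-system argument only bounds the Selmer module in `Λ[1/p, 1/(γ−1)]`
unless (Sel) `corank_{ℤ_p} Sel(K, E[p^∞]) = 1` is available — CGLS 2022 Thm. 4.1.2 «Moreover»).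

* §1 (any integral domain `R`, `R⟦X⟧`): **`mul_mem_span_of_X_pow_mul_mem_span`** — if
  `c · X^ν · L ∈ (g)` and `ord_X g ≤ ord_X L` (`PowerSeries.order`) then `c · L ∈ (g)`. Proof by ORDERS
  (no unique factorisation): `q g = c X^ν L` gives `ord q + ord g = ord c + ν + ord L ≥ ν + ord g`, so
  `X^ν ∣ q` (`PowerSeries.X_pow_order_dvd`) and `X^ν` cancels in the domain `R⟦X⟧`. The hypothesis is
  automatic when `g(0) ≠ 0` (`…_of_constantCoeff_ne_zero`) — on the Leopoldt cell: when the
  characteristic power series of `X_{∅,0}` does not vanish at the trivial character, which is what the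
  control theorem (crux K4) reads as «`Sel_{∅,0}(K, E[3^∞])` finite», i.e. the corank-1 / twist-rank
  situation.
* §2 (`Λ^ur = R₀⟦T⟧`): `exists_C_pow_mul_mem_span_of_X_pow_mul` (the pin with `c = p^μ`) and the
  VALUES-CURRENCY form **`exists_C_pow_mul_mem_span_of_weighted_norm_value_le`**: a WEIGHTED domination
  `‖x‖^ν · ‖L(x)‖ ≤ C · ‖g(x)‖` off a finite set of the open unit disc of `ℂ_p` (the shape of a reducible
  Kolyvagin-system bound, whose error term grows like `‖x‖^{-ν}` towards the trivial character `x = 0`)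
  plus the pin `ord_T g ≤ ord_T L` give `∃ μ, p^μ · L ∈ (g)` — by `…UnrSeriesDomination` applied to
  `T^ν · L`, then §1.
* §3 the ALGEBRAIC points suffice (`…_algebraic`): domination (plain or weighted) at the points of the
  disc lying in `ℚ̄_p ⊂ ℂ_p` outside a finite set — the specialisations `Λ → 𝒪_𝔓` at height-one primes —
  is enough (`ℚ̄_p` is dense in `ℂ_p`; `mem_closure_disc_algebraic_diff_finite`).

HONEST FRAMING: pure algebra on the receptacle; nothing about elliptic curves, Selmer groups or
`L`-functions is constructed or asserted; closes nothing by itself. No definition, no named fact, no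
`sorry`. BSD is not proved by any of this; no summit statement is proved by this seat.

References: [Washington1997] §7.1; [MazurRubin2004] Thm. 5.3.10 (the excluded primes `p`, `γ − 1`);
[CastellaGrossiLeeSkinner2022] Thm. 4.1.2 («Moreover», hypothesis (Sel)); evidence #28 §4b on
stmt-BirchSwinnertonDyer-24198.
-/

set_option autoImplicit false
-- `…BirchSwinnertonDyer.BirchSwinnertonDyer.Theorems…` is the problem's mandated namespace (D-0017).
set_option linter.dupNamespace false

noncomputable section

open scoped Classical

open PowerSeries Literature.NumberTheory.EllipticCurves
  Summit.BirchSwinnertonDyer.Rank1Residual.X11b.Halves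
  Summit.BirchSwinnertonDyer.BirchSwinnertonDyer.Theorems.CumulativeHeegnerInclusionAtThreeUnrSeriesZeros
  Summit.BirchSwinnertonDyer.BirchSwinnertonDyer.Theorems.CumulativeHeegnerInclusionAtThreeUnrSeriesDomination

namespace Summit.BirchSwinnertonDyer.BirchSwinnertonDyer.Theorems.CumulativeHeegnerInclusionAtThreeUnrSeriesTadicPin

/-! ### §1 Cancelling powers of `X` in `R⟦X⟧` against an ideal `(g)` with `ord_X g ≤ ord_X L` -/

section Domain

variable {R : Type*} [CommRing R] [IsDomain R]

/-- **The `T`-adic pin.** In `R⟦X⟧` over an integral domain: if `c · X^ν · L ∈ (g)` and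
`ord_X g ≤ ord_X L`, then `c · L ∈ (g)`. (Orders add under products; `q g = c X^ν L` forces
`ord_X q ≥ ν`, so `X^ν ∣ q` and `X^ν` cancels.) With `c = p^μ` this passes from a divisibility in
`Λ[1/p, 1/T]` to one in `Λ[1/p]`. [cite: MazurRubin2004, Thm. 5.3.10] -/
theorem mul_mem_span_of_X_pow_mul_mem_span {c L g : R⟦X⟧} {ν : ℕ}
    (h : c * X ^ ν * L ∈ Ideal.span {g}) (hord : g.order ≤ L.order) : c * L ∈ Ideal.span {g} := by
  obtain ⟨q, hq⟩ := Ideal.mem_span_singleton'.mp h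
  have hXν : (X : R⟦X⟧) ^ ν ≠ 0 := pow_ne_zero _ X_ne_zero
  -- degenerate cases: `q = 0` or `g = 0` force `c · L = 0`
  by_cases hqg : q * g = 0
  · have hcL : c * L = 0 := by
      rw [hq] at hqg
      rcases mul_eq_zero.mp hqg with h1 | h1
      · rcases mul_eq_zero.mp h1 with h2 | h2
        · rw [h2, zero_mul]
        · exact absurd h2 hXν
      · rw [h1, mul_zero]
    rw [hcL]
    exact Ideal.zero_mem _
  have hq0 : q ≠ 0 := fun h0 ↦ hqg (by rw [h0, zero_mul])
  have hg0 : g ≠ 0 := fun h0 ↦ hqg (by rw [h0, mul_zero])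
  have hcXL : c * X ^ ν * L ≠ 0 := hq ▸ hqg
  have hc0 : c ≠ 0 := fun h0 ↦ hcXL (by rw [h0, zero_mul, zero_mul])
  have hL0 : L ≠ 0 := fun h0 ↦ hcXL (by rw [h0, mul_zero])
  -- all orders are finite
  have hfin : ∀ {φ : R⟦X⟧}, φ ≠ 0 → ((φ.order.toNat : ℕ) : ℕ∞) = φ.order := fun hφ ↦
    ENat.coe_toNat (fun ht ↦ hφ (order_eq_top.mp ht))
  -- `ord q + ord g = ord c + ν + ord L`
  have hordeq : q.order.toNat + g.order.toNat = c.order.toNat + ν + L.order.toNat := by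
    have h1 := congrArg PowerSeries.order hq
    rw [order_mul, order_mul, order_mul, order_X_pow, ← hfin hq0, ← hfin hg0, ← hfin hc0, ← hfin hL0]
      at h1
    exact_mod_cast h1
  have hordle : g.order.toNat ≤ L.order.toNat := by
    have h1 := hord
    rw [← hfin hg0, ← hfin hL0] at h1
    exact_mod_cast h1
  have hν : ν ≤ q.order.toNat := by omega
  -- `X^ν ∣ q`, cancel
  obtain ⟨q₁, hq₁⟩ : (X : R⟦X⟧) ^ ν ∣ q := (pow_dvd_pow X hν).trans X_pow_order_dvd
  refine Ideal.mem_span_singleton'.mpr ⟨q₁, mul_left_cancel₀ hXν ?_⟩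
  calc X ^ ν * (q₁ * g) = q * g := by rw [hq₁, mul_assoc]
    _ = c * X ^ ν * L := hq
    _ = X ^ ν * (c * L) := by ring

/-- The pin is automatic when `g(0) ≠ 0` (`ord_X g = 0`): `c · X^ν · L ∈ (g) ⟹ c · L ∈ (g)`. On the
Leopoldt cell `g(0) ≠ 0` is «the characteristic power series of `X_{∅,0}` does not vanish at the trivial
character» — the corank-1 / twist-rank situation read by the control theorem.
[cite: CastellaGrossiLeeSkinner2022, Thm. 4.1.2] -/
theorem mul_mem_span_of_X_pow_mul_mem_span_of_constantCoeff_ne_zero {c L g : R⟦X⟧} {ν : ℕ}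
    (h : c * X ^ ν * L ∈ Ideal.span {g}) (hg : constantCoeff g ≠ 0) : c * L ∈ Ideal.span {g} := by
  refine mul_mem_span_of_X_pow_mul_mem_span h ((order_le 0 ?_).trans (by simp))
  rwa [coeff_zero_eq_constantCoeff]

/-- Iff form: under the pin `ord_X g ≤ ord_X L`, `c · X^ν · L ∈ (g) ⟺ c · L ∈ (g)`.
[cite: MazurRubin2004, Thm. 5.3.10] -/
theorem X_pow_mul_mem_span_iff {c L g : R⟦X⟧} (ν : ℕ) (hord : g.order ≤ L.order) :
    c * X ^ ν * L ∈ Ideal.span {g} ↔ c * L ∈ Ideal.span {g} := by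
  refine ⟨fun h ↦ mul_mem_span_of_X_pow_mul_mem_span h hord, fun h ↦ ?_⟩
  have : c * X ^ ν * L = X ^ ν * (c * L) := by ring
  rw [this]
  exact Ideal.mul_mem_left _ _ h

end Domain

/-! ### §2 On `Λ^ur = R₀⟦T⟧`: the pin with `c = p^μ`, and its values-currency form -/

variable {p : ℕ} [hp : Fact p.Prime]

/-- **From `Λ^ur[1/p, 1/T]` to `Λ^ur[1/p]`.** If `p^μ T^ν · L ∈ (g)` in `R₀⟦T⟧` for some `μ, ν` and
`ord_T g ≤ ord_T L`, then `p^{μ'} · L ∈ (g)` for some `μ'` (indeed the same `μ`). This is where a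
twist-rank / corank-1 hypothesis enters stub A: it supplies the pin. [cite: MazurRubin2004, Thm. 5.3.10] -/
theorem exists_C_pow_mul_mem_span_of_X_pow_mul {g L : UnrSeries p}
    (h : ∃ μ ν : ℕ, PowerSeries.C (((p : ℕ) : unrIntegers p) ^ μ) * X ^ ν * L ∈ Ideal.span {g})
    (hord : g.order ≤ L.order) :
    ∃ μ : ℕ, PowerSeries.C (((p : ℕ) : unrIntegers p) ^ μ) * L ∈ Ideal.span {g} := by
  haveI : IsDomain (unrIntegers p) := inferInstance
  obtain ⟨μ, ν, hμν⟩ := h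
  exact ⟨μ, mul_mem_span_of_X_pow_mul_mem_span hμν hord⟩

/-- **Weighted domination off a finite set + the `T`-adic pin ⟹ stub A's divisibility.** For `g ≠ 0`, `L`
in `R₀⟦T⟧`: if `‖x‖^ν · ‖L(x)‖ ≤ C · ‖g(x)‖` at every point of the open unit disc of `ℂ_p` outside a
finite set `F` (a Kolyvagin-system bound for a residually reducible representation, whose error grows
like `‖x‖^{-ν}` at the trivial character) and `ord_T g ≤ ord_T L`, then `p^μ · L ∈ (g)` for some `μ`
(`…UnrSeriesDomination.exists_C_pow_mul_mem_span_of_norm_value_le_of_finite` for `T^ν · L`, then §1).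
[cite: Washington1997, §7.1 Thm. 7.3] [cite: MazurRubin2004, Thm. 5.3.10] -/
theorem exists_C_pow_mul_mem_span_of_weighted_norm_value_le {g L : UnrSeries p} (hg : g ≠ 0)
    {F : Set ℂ_[p]} (hF : F.Finite) {ν : ℕ} {C : ℝ}
    (hdom : ∀ x : ℂ_[p], x ∉ F → ‖x‖ < 1 → ∀ u v : ℂ_[p], g.HasValueAt x u → L.HasValueAt x v →
      ‖x‖ ^ ν * ‖v‖ ≤ C * ‖u‖)
    (hord : g.order ≤ L.order) :
    ∃ μ : ℕ, PowerSeries.C (((p : ℕ) : unrIntegers p) ^ μ) * L ∈ Ideal.span {g} := by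
  -- the value of `X^ν · L` at `x` is `x^ν · L(x)`
  have hXν : ∀ x : ℂ_[p], UnrSeries.HasValueAt ((X : UnrSeries p) ^ ν) x (x ^ ν) := by
    intro x
    have h1 := hasValueAt_coe_polynomial (p := p) (Polynomial.X ^ ν) x
    rwa [Polynomial.coe_pow, Polynomial.coe_X, Polynomial.map_pow, Polynomial.map_X,
      Polynomial.eval_pow, Polynomial.eval_X] at h1
  have hdom' : ∀ x : ℂ_[p], x ∉ F → ‖x‖ < 1 → ∀ u v : ℂ_[p], g.HasValueAt x u →
      UnrSeries.HasValueAt ((X : UnrSeries p) ^ ν * L) x v → ‖v‖ ≤ C * ‖u‖ := by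
    intro x hxF hx u v hu hv
    obtain ⟨w, hw⟩ := exists_hasValueAt L hx
    have hv' : v = x ^ ν * w := hv.unique (hasValueAt_mul hx (hXν x) hw)
    rw [hv', norm_mul, norm_pow]
    exact hdom x hxF hx u w hu hw
  obtain ⟨μ, hμ⟩ := exists_C_pow_mul_mem_span_of_norm_value_le_of_finite hg hF hdom'
  refine ⟨μ, mul_mem_span_of_X_pow_mul_mem_span (ν := ν) ?_ hord⟩
  rwa [mul_assoc]

/-- The same with the pin in its most common form `g(0) ≠ 0` (the characteristic power series does
not vanish at the trivial character). [cite: CastellaGrossiLeeSkinner2022, Thm. 4.1.2] -/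
theorem exists_C_pow_mul_mem_span_of_weighted_norm_value_le_of_constantCoeff_ne_zero
    {g L : UnrSeries p} (hg : constantCoeff g ≠ 0) {F : Set ℂ_[p]} (hF : F.Finite) {ν : ℕ} {C : ℝ}
    (hdom : ∀ x : ℂ_[p], x ∉ F → ‖x‖ < 1 → ∀ u v : ℂ_[p], g.HasValueAt x u → L.HasValueAt x v →
      ‖x‖ ^ ν * ‖v‖ ≤ C * ‖u‖) :
    ∃ μ : ℕ, PowerSeries.C (((p : ℕ) : unrIntegers p) ^ μ) * L ∈ Ideal.span {g} := by
  have hg0 : g ≠ 0 := fun h0 ↦ hg (by rw [h0, map_zero])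
  refine exists_C_pow_mul_mem_span_of_weighted_norm_value_le hg0 hF hdom
    ((order_le 0 ?_).trans (by simp))
  rwa [coeff_zero_eq_constantCoeff]

/-! ### §3 The algebraic points suffice: domination at the specialisations `Λ → 𝒪 ⊂ ℚ̄_p` -/

/-- **`ℚ̄_p` is dense in the open disc of `ℂ_p`, even off a finite set**: every `x ∈ ℂ_p` with `‖x‖ < 1`
lies in the closure of the ALGEBRAIC points of the open unit disc outside any finite set `F` (`ℂ_p` is the
completion of `ℚ̄_p`; `ℂ_p` has no isolated points, so `Dense.sdiff_finite`). The specialisations of a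
Kolyvagin-system argument are at height-one primes `𝔓` of `Λ`, i.e. at ALGEBRAIC points of the disc.
[folklore] -/
theorem mem_closure_disc_algebraic_diff_finite {F : Set ℂ_[p]} (hF : F.Finite) {x : ℂ_[p]}
    (hx : ‖x‖ < 1) :
    x ∈ closure {y : ℂ_[p] | ‖y‖ < 1 ∧ y ∈ Set.range ((↑) : PadicAlgCl p → ℂ_[p]) \ F} := by
  have hd : Dense (Set.range ((↑) : PadicAlgCl p → ℂ_[p]) \ F) :=
    (UniformSpace.Completion.denseRange_coe (α := PadicAlgCl p)).sdiff_finite hF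
  have ho : IsOpen {y : ℂ_[p] | ‖y‖ < 1} := isOpen_lt continuous_norm continuous_const
  exact hd.open_subset_closure_inter ho hx

/-- **Domination at the algebraic points suffices.** For `g ≠ 0`, `L` in `R₀⟦T⟧`: if
`‖L(y)‖ ≤ C · ‖g(y)‖` at every `y ∈ ℚ̄_p` with `‖y‖ < 1` outside a finite set (the values at the
specialisations `Λ → 𝒪_𝔓 ⊂ ℚ̄_p` at the height-one primes `𝔓` of a Kolyvagin-system argument), then
`p^μ · L ∈ (g)` for some `μ`. [cite: Washington1997, §7.1 Thm. 7.3] [cite: MazurRubin2004, Thm. 5.3.10] -/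
theorem exists_C_pow_mul_mem_span_of_norm_value_le_algebraic {g L : UnrSeries p} (hg : g ≠ 0)
    {F : Set ℂ_[p]} (hF : F.Finite) {C : ℝ}
    (hdom : ∀ y : PadicAlgCl p, (y : ℂ_[p]) ∉ F → ‖(y : ℂ_[p])‖ < 1 → ∀ u v : ℂ_[p],
      g.HasValueAt y u → L.HasValueAt y v → ‖v‖ ≤ C * ‖u‖) :
    ∃ μ : ℕ, PowerSeries.C (((p : ℕ) : unrIntegers p) ^ μ) * L ∈ Ideal.span {g} := by
  refine exists_C_pow_mul_mem_span_of_norm_value_le hg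
    (S := Set.range ((↑) : PadicAlgCl p → ℂ_[p]) \ F)
    (fun x hx ↦ mem_closure_disc_algebraic_diff_finite hF hx) (C := C) ?_
  rintro x ⟨⟨y, rfl⟩, hxF⟩ hx u v hu hv
  exact hdom y hxF hx u v hu hv

/-- **Weighted domination at the algebraic points + the `T`-adic pin ⟹ stub A's divisibility**: if
`‖y‖^ν · ‖L(y)‖ ≤ C · ‖g(y)‖` at every algebraic point `y` of the open disc outside a finite set and
`ord_T g ≤ ord_T L`, then `p^μ · L ∈ (g)` for some `μ`.
[cite: Washington1997, §7.1 Thm. 7.3] [cite: MazurRubin2004, Thm. 5.3.10] -/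
theorem exists_C_pow_mul_mem_span_of_weighted_norm_value_le_algebraic {g L : UnrSeries p} (hg : g ≠ 0)
    {F : Set ℂ_[p]} (hF : F.Finite) {ν : ℕ} {C : ℝ}
    (hdom : ∀ y : PadicAlgCl p, (y : ℂ_[p]) ∉ F → ‖(y : ℂ_[p])‖ < 1 → ∀ u v : ℂ_[p],
      g.HasValueAt y u → L.HasValueAt y v → ‖(y : ℂ_[p])‖ ^ ν * ‖v‖ ≤ C * ‖u‖)
    (hord : g.order ≤ L.order) :
    ∃ μ : ℕ, PowerSeries.C (((p : ℕ) : unrIntegers p) ^ μ) * L ∈ Ideal.span {g} := by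
  have hXν : ∀ x : ℂ_[p], UnrSeries.HasValueAt ((X : UnrSeries p) ^ ν) x (x ^ ν) := by
    intro x
    have h1 := hasValueAt_coe_polynomial (p := p) (Polynomial.X ^ ν) x
    rwa [Polynomial.coe_pow, Polynomial.coe_X, Polynomial.map_pow, Polynomial.map_X,
      Polynomial.eval_pow, Polynomial.eval_X] at h1
  have hdom' : ∀ y : PadicAlgCl p, (y : ℂ_[p]) ∉ F → ‖(y : ℂ_[p])‖ < 1 → ∀ u v : ℂ_[p],
      g.HasValueAt y u → UnrSeries.HasValueAt ((X : UnrSeries p) ^ ν * L) y v → ‖v‖ ≤ C * ‖u‖ := by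
    intro y hyF hy u v hu hv
    obtain ⟨w, hw⟩ := exists_hasValueAt L hy
    have hv' : v = (y : ℂ_[p]) ^ ν * w := hv.unique (hasValueAt_mul hy (hXν y) hw)
    rw [hv', norm_mul, norm_pow]
    exact hdom y hyF hy u w hu hw
  obtain ⟨μ, hμ⟩ := exists_C_pow_mul_mem_span_of_norm_value_le_algebraic hg hF hdom'
  refine ⟨μ, mul_mem_span_of_X_pow_mul_mem_span (ν := ν) ?_ hord⟩
  rwa [mul_assoc]

end Summit.BirchSwinnertonDyer.BirchSwinnertonDyer.Theorems.CumulativeHeegnerInclusionAtThreeUnrSeriesTadicPin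

end
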